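import Summits.ValiantsHypothesis.ValiantsHypothesis.Theorems.BarrierLeverAnchoredDoorHitsLowerPairsSplitGeneralFaces

/-!
# Support item `AnchoredDoorHitsLowerPairs` (stmt-ValiantsHypothesis-22510), line `anchored-peeling`:
# CONJECTURE SP for all `m` — part 7: ROW SUMS OF A VANISHING COMBINATION OF LIMIT COLUMNS

Helper file (`--supports stmt-ValiantsHypothesis-22510`; cell valiant-natproofs, rung V4, 𝒟-side door (c); registered line
`Cruxes/AnchoredDoorHitsLowerPairs/Lines/anchored_peeling.lean` v24, registered stub `stub_splitFamilyGe3`; prover seat val-np-p1 gen 24;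
memo HOME/val-np-p1/g24/MEMO-SP-proof-valnp1-g24.md §2.2, §6 B3). Closes NO item.

WHAT. For a coefficient vector `g` on the faces of the split graph, the combination `Σ_E g E · topCol m E` of the LIMIT columns is evaluated at every row
`rowC m S e T` (`rowSum_eq`): rows without `α` see only personas (`rowSum_noalpha`: the (R1) equations of memo §2.2, incl. `Σ_{P ∈ parts S} g2 = −2 g1 S`),
rows with `α` see the `α`-parts through the closed form `aco_sum` (`rowSum_alpha`). The sequel `…SplitGeneralLimit` specialises these to the core system.

WHAT THIS IS NOT: nothing on crux stmt-ValiantsHypothesis-14610 or on `VP` versus `VNP`.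
-/

set_option linter.dupNamespace false

namespace Summit.ValiantsHypothesis.ValiantsHypothesis.Theorems.BarrierLever.AnchoredPeeling

namespace SplitGeneral

open Finset DecFamily

variable {m : ℕ}

/-! ## 1. Unknowns attached to a coefficient vector -/

/-- Coefficient of the clique vertex `v_P` (`P = ∅` is `ω`). -/
def g1 (g : Finset ℕ → ℂ) (P : Finset ℕ) : ℂ := g {enc P}

/-- Coefficient of the clique edge `{v_P, v_P'}` (zero on the diagonal). -/
noncomputable def g2 (g : Finset ℕ → ℂ) (P P' : Finset ℕ) : ℂ := if P = P' then 0 else g {enc P, enc P'}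

/-- Coefficient of the independent vertex `u_t`. -/
def gu (m : ℕ) (g : Finset ℕ → ℂ) (t : Finset ℕ) : ℂ := g {yu m t}

/-- Coefficient of the edge `{v_P, u_t}` (`P = ∅`: the edge `{ω, u_t}`). -/
def gvu (m : ℕ) (g : Finset ℕ → ℂ) (P t : Finset ℕ) : ℂ := g {enc P, yu m t}

/-- `g2` is symmetric. -/
theorem g2_symm (g : Finset ℕ → ℂ) (P P' : Finset ℕ) : g2 g P P' = g2 g P' P := by
  unfold g2
  by_cases h : P = P'
  · rw [if_pos h, if_pos h.symm]
  · rw [if_neg h, if_neg (Ne.symm h), Finset.pair_comm]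

/-- Off the diagonal `g2` is the face coefficient. -/
theorem g2_of_ne (g : Finset ℕ → ℂ) {P P' : Finset ℕ} (h : P ≠ P') : g2 g P P' = g {enc P, enc P'} := if_neg h

/-! ## 2. Indicator algebra -/

section Ind

/-- `ind` of a true proposition. -/
theorem ind_true {p : Prop} [Decidable p] (h : p) : ind p = 1 := if_pos h

/-- `ind` of a false proposition. -/
theorem ind_false {p : Prop} [Decidable p] (h : ¬ p) : ind p = 0 := if_neg h

/-- `ind` respects `↔`. -/
theorem ind_congr {p q : Prop} [Decidable p] [Decidable q] (h : p ↔ q) : ind p = ind q := by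
  unfold ind; exact if_congr h rfl rfl

/-- `ind` of a conjunction. -/
theorem ind_and (p q : Prop) [Decidable p] [Decidable q] : ind (p ∧ q) = ind p * ind q := by
  unfold ind; by_cases hp : p <;> by_cases hq : q <;> simp [hp, hq]

/-- A sum against `ind (x = a)`. -/
theorem sum_mul_ind_eq {ι : Type*} [DecidableEq ι] (s : Finset ι) (f : ι → ℂ) (a : ι) :
    ∑ x ∈ s, f x * ind (x = a) = if a ∈ s then f a else 0 := by
  unfold ind; simp_rw [mul_ite, mul_one, mul_zero]; exact Finset.sum_ite_eq' s a f

/-- `ind` of a negation. -/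
theorem ind_not (p : Prop) [Decidable p] : ind (¬ p) = 1 - ind p := by
  unfold ind; by_cases hp : p <;> simp [hp]

/-- A sum against `ind (x = a ∨ x = b)` for distinct members `a, b`. -/
theorem sum_mul_ind_eq_or {ι : Type*} [DecidableEq ι] (s : Finset ι) (f : ι → ℂ) {a b : ι} (ha : a ∈ s) (hb : b ∈ s) (hab : a ≠ b) :
    ∑ x ∈ s, f x * ind (x = a ∨ x = b) = f a + f b := by
  have : ∀ x ∈ s, f x * ind (x = a ∨ x = b) = f x * ind (x = a) + f x * ind (x = b) := by
    intro x _
    rw [← mul_add]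
    congr 1
    unfold ind
    by_cases hxa : x = a
    · subst hxa; rw [if_pos (Or.inl rfl), if_pos rfl, if_neg hab, add_zero]
    · by_cases hxb : x = b
      · rw [if_pos (Or.inr hxb), if_neg hxa, if_pos hxb, zero_add]
      · rw [if_neg (fun h => h.elim hxa hxb), if_neg hxa, if_neg hxb, add_zero]
  rw [Finset.sum_congr rfl this, Finset.sum_add_distrib, sum_mul_ind_eq, sum_mul_ind_eq, if_pos ha, if_pos hb]

end Ind

/-! ## 3. The row sum -/

/-- **The combination `Σ_E g E · topCol E` at the row `(S, e, T)`.** -/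
theorem rowSum_eq (g : Finset ℕ → ℂ) {S T : Finset ℕ} (hS : S ⊆ range (m + 1)) (hT : T ⊆ range m) (e : Bool) :
    ∑ E ∈ codeFaces m, g E * topCol m E (rowC m S e T) =
      g ∅ * ind (S = ∅ ∧ e = false ∧ T = ∅) +
      ∑ P ∈ cliqueSets m, g1 g P * (ind (P ≠ ∅ ∧ S = P ∧ e = false ∧ T = ∅) + ind (e = true) * aco m P S T) +
      ∑ t ∈ smallSets m, gu m g t * ind (S = ∅ ∧ e = false ∧ T = t) +
      ∑ pp ∈ ltPairs m, g {enc pp.1, enc pp.2} *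
        (ind (pp.1 ≠ ∅ ∧ pp.2 ≠ ∅ ∧ Disjoint pp.1 pp.2 ∧ S = pp.1 ∪ pp.2 ∧ e = false ∧ T = ∅) +
          ind (e = true) * (ind (pp.1 ≠ ∅ ∧ pp.1 ⊆ S) * aco m pp.2 (S \ pp.1) T + ind (pp.2 ≠ ∅ ∧ pp.2 ⊆ S) * aco m pp.1 (S \ pp.2) T)) +
      ∑ pt ∈ cliqueSets m ×ˢ smallSets m, gvu m g pt.1 pt.2 *
        (ind (pt.1 ≠ ∅ ∧ S = pt.1 ∧ e = false ∧ T = pt.2) + ind (e = true ∧ pt.2 ⊆ T) * aco m pt.1 S (T \ pt.2)) := by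
  rw [sum_codeFaces]
  have h0 : topCol m ∅ (rowC m S e T) = ind (S = ∅ ∧ e = false ∧ T = ∅) := by
    rw [topCol_empty]; exact ind_congr (rowC_eq_persona_iff (Finset.empty_subset _) hS)
  rw [h0]
  congr 1; congr 1; congr 1; congr 1
  · refine Finset.sum_congr rfl (fun P hP => ?_)
    rw [g1, topCol_singleton, vtopN_clique_rowC (mem_cliqueSets.mp hP) hS hT]
  · refine Finset.sum_congr rfl (fun t ht => ?_)
    rw [gu, topCol_singleton, vtopN_indep_rowC ht hS]
  · refine Finset.sum_congr rfl (fun pp hpp => ?_)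
    obtain ⟨h1, h2, hlt⟩ := mem_ltPairs.mp hpp
    rw [topCol_pair hlt, conv_vv_rowC (mem_cliqueSets.mp h1) (mem_cliqueSets.mp h2) hS hT]
  · refine Finset.sum_congr rfl (fun pt hpt => ?_)
    obtain ⟨h1, h2⟩ := Finset.mem_product.mp hpt
    rw [gvu, topCol_pair (enc_lt_yu h1 h2), conv_vu_rowC (mem_cliqueSets.mp h1) h2 hS hT]

/-! ## 4. Rows without `α`: the (R1) equations -/

/-- **Rows without `α`.** -/
theorem rowSum_noalpha (g : Finset ℕ → ℂ) {S T : Finset ℕ} (hS : S ⊆ range (m + 1)) (hT : T ⊆ range m) :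
    ∑ E ∈ codeFaces m, g E * topCol m E (rowC m S false T) =
      g ∅ * ind (S = ∅ ∧ T = ∅) + ind (S ≠ ∅ ∧ T = ∅) * g1 g S + ind (S = ∅ ∧ T ≠ ∅) * gu m g T + ind (S ≠ ∅ ∧ T ≠ ∅) * gvu m g S T +
        ind (T = ∅) * ∑ pp ∈ ltPairs m, g {enc pp.1, enc pp.2} * ind (pp.1 ≠ ∅ ∧ pp.2 ≠ ∅ ∧ Disjoint pp.1 pp.2 ∧ S = pp.1 ∪ pp.2) := by
  classical
  rw [rowSum_eq g hS hT]
  have hf : ind (false = true) = 0 := ind_false Bool.false_ne_true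
  -- term 0
  have e0 : ind (S = ∅ ∧ false = false ∧ T = ∅) = ind (S = ∅ ∧ T = ∅) := ind_congr (by simp)
  -- term 1
  have e1 : ∑ P ∈ cliqueSets m, g1 g P * (ind (P ≠ ∅ ∧ S = P ∧ false = false ∧ T = ∅) + ind (false = true) * aco m P S T) =
      ind (S ≠ ∅ ∧ T = ∅) * g1 g S := by
    have : ∀ P ∈ cliqueSets m, g1 g P * (ind (P ≠ ∅ ∧ S = P ∧ false = false ∧ T = ∅) + ind (false = true) * aco m P S T) =
        (g1 g P * ind (S ≠ ∅ ∧ T = ∅)) * ind (P = S) := by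
      intro P _
      rw [hf, zero_mul, add_zero, mul_assoc, ← ind_and]
      congr 1
      exact ind_congr ⟨fun h => ⟨⟨h.2.1 ▸ h.1, h.2.2.2⟩, h.2.1.symm⟩, fun h => ⟨h.2 ▸ h.1.1, h.2.symm, rfl, h.1.2⟩⟩
    rw [Finset.sum_congr rfl this, sum_mul_ind_eq, if_pos (mem_cliqueSets.mpr hS), mul_comm]
  -- term 2
  have e2 : ∑ t ∈ smallSets m, gu m g t * ind (S = ∅ ∧ false = false ∧ T = t) = ind (S = ∅ ∧ T ≠ ∅) * gu m g T := by
    have : ∀ t ∈ smallSets m, gu m g t * ind (S = ∅ ∧ false = false ∧ T = t) = (gu m g t * ind (S = ∅ ∧ T ≠ ∅)) * ind (t = T) := by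
      intro t ht
      rw [mul_assoc, ← ind_and]
      congr 1
      exact ind_congr ⟨fun h => ⟨⟨h.1, h.2.2 ▸ (mem_smallSets.mp ht).2⟩, h.2.2.symm⟩, fun h => ⟨h.1.1, rfl, h.2.symm⟩⟩
    rw [Finset.sum_congr rfl this, sum_mul_ind_eq]
    by_cases hT0 : T ≠ ∅
    · by_cases hTs : T ∈ smallSets m
      · rw [if_pos hTs, mul_comm]
      · exact absurd (mem_smallSets.mpr ⟨hT, hT0⟩) hTs
    · rw [ind_false (fun h => hT0 h.2), mul_zero, zero_mul, ite_self]
  -- term 3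
  have e3 : ∑ pp ∈ ltPairs m, g {enc pp.1, enc pp.2} *
        (ind (pp.1 ≠ ∅ ∧ pp.2 ≠ ∅ ∧ Disjoint pp.1 pp.2 ∧ S = pp.1 ∪ pp.2 ∧ false = false ∧ T = ∅) +
          ind (false = true) * (ind (pp.1 ≠ ∅ ∧ pp.1 ⊆ S) * aco m pp.2 (S \ pp.1) T + ind (pp.2 ≠ ∅ ∧ pp.2 ⊆ S) * aco m pp.1 (S \ pp.2) T)) =
      ind (T = ∅) * ∑ pp ∈ ltPairs m, g {enc pp.1, enc pp.2} * ind (pp.1 ≠ ∅ ∧ pp.2 ≠ ∅ ∧ Disjoint pp.1 pp.2 ∧ S = pp.1 ∪ pp.2) := by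
    rw [Finset.mul_sum]
    refine Finset.sum_congr rfl (fun pp _ => ?_)
    rw [hf, zero_mul, add_zero, mul_left_comm, ← ind_and]
    congr 1
    exact ind_congr ⟨fun h => ⟨h.2.2.2.2.2, h.1, h.2.1, h.2.2.1, h.2.2.2.1⟩, fun h => ⟨h.2.1, h.2.2.1, h.2.2.2.1, h.2.2.2.2, rfl, h.1⟩⟩
  -- term 4
  have e4 : ∑ pt ∈ cliqueSets m ×ˢ smallSets m, gvu m g pt.1 pt.2 *
        (ind (pt.1 ≠ ∅ ∧ S = pt.1 ∧ false = false ∧ T = pt.2) + ind (false = true ∧ pt.2 ⊆ T) * aco m pt.1 S (T \ pt.2)) =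
      ind (S ≠ ∅ ∧ T ≠ ∅) * gvu m g S T := by
    have : ∀ pt ∈ cliqueSets m ×ˢ smallSets m, gvu m g pt.1 pt.2 *
        (ind (pt.1 ≠ ∅ ∧ S = pt.1 ∧ false = false ∧ T = pt.2) + ind (false = true ∧ pt.2 ⊆ T) * aco m pt.1 S (T \ pt.2)) =
        (gvu m g pt.1 pt.2 * ind (S ≠ ∅ ∧ T ≠ ∅)) * ind (pt = (S, T)) := by
      intro pt hpt
      have ht2 := (mem_smallSets.mp (Finset.mem_product.mp hpt).2).2
      rw [ind_false (show ¬ (false = true ∧ pt.2 ⊆ T) from fun h => Bool.false_ne_true h.1), zero_mul, add_zero, mul_assoc, ← ind_and]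
      congr 1
      refine ind_congr ⟨fun h => ⟨⟨h.2.1 ▸ h.1, h.2.2.2 ▸ ht2⟩, Prod.ext h.2.1.symm h.2.2.2.symm⟩, fun h => ?_⟩
      have h1 : pt.1 = S := congrArg Prod.fst h.2
      have h2 : pt.2 = T := congrArg Prod.snd h.2
      exact ⟨h1 ▸ h.1.1, h1.symm, rfl, h2.symm⟩
    rw [Finset.sum_congr rfl this, sum_mul_ind_eq]
    by_cases hc : S ≠ ∅ ∧ T ≠ ∅
    · rw [if_pos (Finset.mem_product.mpr ⟨mem_cliqueSets.mpr hS, mem_smallSets.mpr ⟨hT, hc.2⟩⟩), mul_comm]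
    · rw [ind_false hc, mul_zero, zero_mul, ite_self]
  rw [e0, e1, e2, e3, e4]
  ring

/-- (R1a) Row `∅`. -/
theorem rowSum_R1a (g : Finset ℕ → ℂ) : ∑ E ∈ codeFaces m, g E * topCol m E (rowC m ∅ false ∅) = g ∅ := by
  rw [rowSum_noalpha g (Finset.empty_subset _) (Finset.empty_subset _)]
  rw [ind_true ⟨rfl, rfl⟩, ind_false (fun h => h.1 rfl), ind_false (fun h => h.2 rfl), ind_false (fun h => h.1 rfl), ind_true rfl]
  rw [Finset.sum_eq_zero (fun pp _ => by
    rw [ind_false (fun h => h.1 (Finset.subset_empty.mp (h.2.2.2 ▸ Finset.subset_union_left))), mul_zero])]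
  ring

/-- (R1b) Row `sh t`. -/
theorem rowSum_R1b (g : Finset ℕ → ℂ) {t : Finset ℕ} (ht : t ∈ smallSets m) :
    ∑ E ∈ codeFaces m, g E * topCol m E (rowC m ∅ false t) = gu m g t := by
  have ht' := mem_smallSets.mp ht
  rw [rowSum_noalpha g (Finset.empty_subset _) ht'.1]
  rw [ind_false (fun h => ht'.2 h.2), ind_false (fun h => h.1 rfl), ind_true ⟨rfl, ht'.2⟩, ind_false (fun h => h.1 rfl), ind_false ht'.2]
  ring

/-- (R1c) Row `S ⊔ sh t`, `S ≠ ∅`. -/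
theorem rowSum_R1c (g : Finset ℕ → ℂ) {S t : Finset ℕ} (hS : S ⊆ range (m + 1)) (hS0 : S ≠ ∅) (ht : t ∈ smallSets m) :
    ∑ E ∈ codeFaces m, g E * topCol m E (rowC m S false t) = gvu m g S t := by
  have ht' := mem_smallSets.mp ht
  rw [rowSum_noalpha g hS ht'.1]
  rw [ind_false (fun h => hS0 h.1), ind_false (fun h => ht'.2 h.2), ind_false (fun h => hS0 h.1), ind_true ⟨hS0, ht'.2⟩, ind_false ht'.2]
  ring

/-- (R1d) Row `S`, `S ≠ ∅`: the vertex and its splittings. -/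
theorem rowSum_R1d (g : Finset ℕ → ℂ) {S : Finset ℕ} (hS : S ⊆ range (m + 1)) (hS0 : S ≠ ∅) :
    ∑ E ∈ codeFaces m, g E * topCol m E (rowC m S false ∅) =
      g1 g S + ∑ pp ∈ ltPairs m, g {enc pp.1, enc pp.2} * ind (pp.1 ≠ ∅ ∧ pp.2 ≠ ∅ ∧ Disjoint pp.1 pp.2 ∧ S = pp.1 ∪ pp.2) := by
  rw [rowSum_noalpha g hS (Finset.empty_subset _)]
  rw [ind_false (fun h => hS0 h.1), ind_true ⟨hS0, rfl⟩, ind_false (fun h => hS0 h.1), ind_false (fun h => h.2 rfl), ind_true rfl]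
  ring

/-- **The splitting sum in `g2`-form**: `Σ_{P ∈ parts S} g2 P (S ∖ P)` is twice the increasing-pair sum of the persona row. -/
theorem sum_parts_g2 (g : Finset ℕ → ℂ) {S : Finset ℕ} (hS : S ⊆ range (m + 1)) :
    ∑ P ∈ parts S, g2 g P (S \ P) =
      2 * ∑ pp ∈ ltPairs m, g {enc pp.1, enc pp.2} * ind (pp.1 ≠ ∅ ∧ pp.2 ≠ ∅ ∧ Disjoint pp.1 pp.2 ∧ S = pp.1 ∪ pp.2) := by
  classical
  set G : Finset ℕ → Finset ℕ → ℂ := fun P P' => g2 g P P' * ind (P ≠ ∅ ∧ P' ≠ ∅ ∧ Disjoint P P' ∧ S = P ∪ P') with hG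
  have hsymm : ∀ P P', G P' P = G P P' := by
    intro P P'
    show g2 g P' P * ind (P' ≠ ∅ ∧ P ≠ ∅ ∧ Disjoint P' P ∧ S = P' ∪ P) = g2 g P P' * ind (P ≠ ∅ ∧ P' ≠ ∅ ∧ Disjoint P P' ∧ S = P ∪ P')
    rw [g2_symm]
    congr 1
    exact ind_congr ⟨fun h => ⟨h.2.1, h.1, h.2.2.1.symm, h.2.2.2.trans (Finset.union_comm _ _)⟩,
      fun h => ⟨h.2.1, h.1, h.2.2.1.symm, h.2.2.2.trans (Finset.union_comm _ _)⟩⟩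
  have hlt : ∑ pp ∈ ltPairs m, g {enc pp.1, enc pp.2} * ind (pp.1 ≠ ∅ ∧ pp.2 ≠ ∅ ∧ Disjoint pp.1 pp.2 ∧ S = pp.1 ∪ pp.2) =
      ∑ pp ∈ ltPairs m, G pp.1 pp.2 := by
    refine Finset.sum_congr rfl (fun pp hpp => ?_)
    show _ = g2 g pp.1 pp.2 * _
    rw [g2_of_ne g (fun h => lt_irrefl _ (h ▸ (mem_ltPairs.mp hpp).2.2))]
  have hdouble : 2 * ∑ pp ∈ ltPairs m, G pp.1 pp.2 = ∑ pp ∈ (cliqueSets m ×ˢ cliqueSets m).filter (fun pp => pp.1 ≠ pp.2), G pp.1 pp.2 := by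
    rw [two_mul, ← Finset.sum_add_distrib, ← sum_pairs_lt]
    exact Finset.sum_congr rfl (fun pp _ => by rw [hsymm pp.1 pp.2])
  rw [hlt, hdouble]
  -- both sides are sums over splittings; biject `P ↦ (P, S ∖ P)`; off the splittings `G` vanishes
  symm
  rw [← Finset.sum_filter_add_sum_filter_not _ (fun pp : Finset ℕ × Finset ℕ => pp.1 ≠ ∅ ∧ pp.2 ≠ ∅ ∧ Disjoint pp.1 pp.2 ∧ S = pp.1 ∪ pp.2)]
  have hzero : ∑ pp ∈ ((cliqueSets m ×ˢ cliqueSets m).filter (fun pp => pp.1 ≠ pp.2)).filter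
      (fun pp => ¬ (pp.1 ≠ ∅ ∧ pp.2 ≠ ∅ ∧ Disjoint pp.1 pp.2 ∧ S = pp.1 ∪ pp.2)), G pp.1 pp.2 = 0 :=
    Finset.sum_eq_zero (fun pp hpp => by
      show g2 g pp.1 pp.2 * ind _ = 0
      rw [ind_false (Finset.mem_filter.mp hpp).2, mul_zero])
  rw [hzero, add_zero]
  refine Finset.sum_nbij' (fun pp => pp.1) (fun P => (P, S \ P)) ?_ ?_ ?_ ?_ ?_
  · intro pp hpp
    obtain ⟨-, hc⟩ := Finset.mem_filter.mp hpp
    refine mem_parts.mpr ⟨hc.2.2.2 ▸ Finset.subset_union_left, hc.1, fun h => hc.2.1 ?_⟩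
    have : pp.2 ⊆ pp.1 := h ▸ (hc.2.2.2 ▸ Finset.subset_union_right)
    exact Finset.subset_empty.mp (fun x hx => (Finset.disjoint_left.mp hc.2.2.1 (this hx) hx).elim)
  · intro P hP
    obtain ⟨hPS, hP0, hPne⟩ := mem_parts.mp hP
    have hQ0 : S \ P ≠ ∅ := fun h => hPne (Finset.Subset.antisymm hPS (Finset.sdiff_eq_empty_iff_subset.mp h))
    refine Finset.mem_filter.mpr ⟨Finset.mem_filter.mpr ⟨Finset.mem_product.mpr ⟨mem_cliqueSets.mpr (hPS.trans hS),
      mem_cliqueSets.mpr (Finset.sdiff_subset.trans hS)⟩, ?_⟩, hP0, hQ0, Finset.disjoint_sdiff, (Finset.union_sdiff_of_subset hPS).symm⟩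
    show P ≠ S \ P
    intro h
    have : P ∩ (S \ P) = P := by rw [← h, Finset.inter_self]
    rw [Finset.inter_sdiff_self] at this
    exact hP0 this.symm
  · intro pp hpp
    obtain ⟨-, hc⟩ := Finset.mem_filter.mp hpp
    refine Prod.ext rfl ?_
    show S \ pp.1 = pp.2
    rw [hc.2.2.2, Finset.union_sdiff_left, Finset.sdiff_eq_self_iff_disjoint]
    exact hc.2.2.1.symm
  · intro P _; rfl
  · intro pp hpp
    obtain ⟨-, hc⟩ := Finset.mem_filter.mp hpp
    show g2 g pp.1 pp.2 * ind _ = g2 g pp.1 (S \ pp.1)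
    rw [ind_true hc, mul_one]
    congr 1
    rw [hc.2.2.2, Finset.union_sdiff_left, eq_comm, Finset.sdiff_eq_self_iff_disjoint]
    exact hc.2.2.1.symm

/-! ## 5. Rows with `α`: the closed form of the `α`-sums -/

/-- The vertices `P' ∉ {∅, {m}}` whose `α`-part reads the `b`-index set `T ≠ ∅`: exactly `T` and `insert m T`. -/
theorem erase_eq_iff {P' T : Finset ℕ} (hmT : m ∉ T) :
    (P' ≠ ∅ ∧ P' ≠ {m} ∧ P'.erase m = T) ↔ (T ≠ ∅ ∧ (P' = T ∨ P' = insert m T)) := by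
  constructor
  · rintro ⟨h0, hm, he⟩
    by_cases hmP : m ∈ P'
    · have hP : P' = insert m T := by rw [← he, Finset.insert_erase hmP]
      refine ⟨fun hT => hm ?_, Or.inr hP⟩
      rw [hP, hT]; rfl
    · have hP : P' = T := by rw [← he, Finset.erase_eq_of_notMem hmP]
      exact ⟨hP ▸ h0, Or.inl hP⟩
  · rintro ⟨hT0, rfl | rfl⟩
    · refine ⟨hT0, fun h => hmT (h ▸ Finset.mem_singleton_self m), Finset.erase_eq_of_notMem hmT⟩
    · refine ⟨Finset.insert_ne_empty _ _, fun h => hT0 ?_, Finset.erase_insert hmT⟩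
      have hsub : T ⊆ {m} := h ▸ Finset.subset_insert m T
      exact Finset.subset_empty.mp (fun x hx => absurd (Finset.mem_singleton.mp (hsub hx) ▸ hx) hmT)

/-- **Closed form of `Σ_{P'} γ P' · aco P' R T`** (the four contributing vertices `∅`, `{m}`, `T`, `insert m T`). -/
theorem aco_sum (γ : Finset ℕ → ℂ) {R T : Finset ℕ} (hT : T ⊆ range m) :
    ∑ P' ∈ cliqueSets m, γ P' * aco m P' R T =
      ind (R = ∅ ∧ T = ∅) * (γ ∅ + γ {m}) +
        ind (R = ∅ ∧ T ≠ ∅) * (γ {m} + γ T + (cw m (insert m T) : ℂ) * γ (insert m T)) + ind (R = {m} ∧ T ≠ ∅) * γ T := by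
  classical
  have hmT : m ∉ T := fun h => by have := Finset.mem_range.mp (hT h); omega
  have hTr : T ⊆ range (m + 1) := hT.trans (Finset.range_subset_range.mpr (Nat.le_succ m))
  have hiT : insert m T ⊆ range (m + 1) := Finset.insert_subset (Finset.mem_range.mpr (Nat.lt_succ_self m)) hTr
  have hmr : ({m} : Finset ℕ) ∈ cliqueSets m := mem_cliqueSets.mpr (Finset.singleton_subset_iff.mpr (Finset.mem_range.mpr (Nat.lt_succ_self m)))
  have h0r : (∅ : Finset ℕ) ∈ cliqueSets m := mem_cliqueSets.mpr (Finset.empty_subset _)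
  have hTi : T ≠ insert m T := fun h => hmT (h ▸ Finset.mem_insert_self m T)
  have hcwT : (cw m T : ℂ) = 1 := by unfold cw; rw [if_neg (fun h => hmT h.1)]; simp
  -- pointwise form of the summand
  have hval : ∀ P' ∈ cliqueSets m, γ P' * aco m P' R T =
      γ ∅ * ind (R = ∅ ∧ T = ∅) * ind (P' = ∅) + γ {m} * ind (R = ∅) * ind (P' = {m}) +
      ind (T ≠ ∅) * (γ P' * (cw m P' : ℂ) * ind (R = ∅)) * ind (P' = T ∨ P' = insert m T) +
      ind (T ≠ ∅) * (γ P' * (cw m P' : ℂ) * ind (m ∉ P' ∧ R = {m})) * ind (P' = T ∨ P' = insert m T) := by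
    intro P' _
    unfold aco
    by_cases h0 : P' = ∅
    · subst h0
      rw [if_pos rfl, ind_true (rfl : (∅ : Finset ℕ) = ∅), ind_false (show ¬ (∅ : Finset ℕ) = {m} from fun h => Finset.singleton_ne_empty m h.symm)]
      by_cases hT0 : T = ∅
      · rw [ind_false (show ¬ T ≠ ∅ from not_not.mpr hT0)]; ring
      · rw [ind_false (show ¬ ((∅ : Finset ℕ) = T ∨ (∅ : Finset ℕ) = insert m T) from
          fun h => h.elim (fun h => hT0 h.symm) (fun h => Finset.insert_ne_empty m T h.symm))]
        ring
    · rw [if_neg h0, ind_false h0]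
      by_cases hm : P' = {m}
      · subst hm
        rw [if_pos rfl, ind_true (rfl : ({m} : Finset ℕ) = {m})]
        by_cases hT0 : T = ∅
        · rw [ind_false (show ¬ T ≠ ∅ from not_not.mpr hT0)]; ring
        · rw [ind_false (show ¬ (({m} : Finset ℕ) = T ∨ ({m} : Finset ℕ) = insert m T) from fun h => h.elim
            (fun h => hmT (h ▸ Finset.mem_singleton_self m))
            (fun h => hT0 (Finset.subset_empty.mp (fun x hx => absurd (Finset.mem_singleton.mp ((h.symm ▸ Finset.subset_insert m T) hx) ▸ hx) hmT))))]
          ring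
      · rw [if_neg hm, ind_false hm]
        have key : ind (R = ∅ ∧ T = P'.erase m) = ind (T ≠ ∅) * ind (R = ∅) * ind (P' = T ∨ P' = insert m T) := by
          rw [← ind_and, ← ind_and]
          refine ind_congr ⟨fun h => ?_, fun h => ⟨h.1.2, ?_⟩⟩
          · have := (erase_eq_iff (m := m) hmT).mp ⟨h0, hm, h.2.symm⟩
            exact ⟨⟨this.1, h.1⟩, this.2⟩
          · exact ((erase_eq_iff (m := m) hmT).mpr ⟨h.1.1, h.2⟩).2.2.symm
        have key2 : ind (m ∉ P' ∧ R = {m} ∧ T = P'.erase m) = ind (T ≠ ∅) * ind (m ∉ P' ∧ R = {m}) * ind (P' = T ∨ P' = insert m T) := by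
          rw [← ind_and, ← ind_and]
          refine ind_congr ⟨fun h => ?_, fun h => ⟨h.1.2.1, h.1.2.2, ?_⟩⟩
          · have := (erase_eq_iff (m := m) hmT).mp ⟨h0, hm, h.2.2.symm⟩
            exact ⟨⟨this.1, h.1, h.2.1⟩, this.2⟩
          · exact ((erase_eq_iff (m := m) hmT).mpr ⟨h.1.1, h.2⟩).2.2.symm
        rw [key, key2]
        ring
  rw [Finset.sum_congr rfl hval, Finset.sum_add_distrib, Finset.sum_add_distrib, Finset.sum_add_distrib, sum_mul_ind_eq, if_pos h0r,
    sum_mul_ind_eq, if_pos hmr]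
  have h3 : ∑ P' ∈ cliqueSets m, ind (T ≠ ∅) * (γ P' * (cw m P' : ℂ) * ind (R = ∅)) * ind (P' = T ∨ P' = insert m T) =
      ind (T ≠ ∅) * ind (R = ∅) * (γ T + (cw m (insert m T) : ℂ) * γ (insert m T)) := by
    rw [sum_mul_ind_eq_or _ _ (mem_cliqueSets.mpr hTr) (mem_cliqueSets.mpr hiT) hTi, hcwT]; ring
  have h4 : ∑ P' ∈ cliqueSets m, ind (T ≠ ∅) * (γ P' * (cw m P' : ℂ) * ind (m ∉ P' ∧ R = {m})) * ind (P' = T ∨ P' = insert m T) =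
      ind (T ≠ ∅) * ind (R = {m}) * γ T := by
    rw [sum_mul_ind_eq_or _ _ (mem_cliqueSets.mpr hTr) (mem_cliqueSets.mpr hiT) hTi, hcwT,
      ind_congr (show (m ∉ T ∧ R = {m}) ↔ R = {m} from ⟨fun h => h.2, fun h => ⟨hmT, h⟩⟩),
      ind_false (show ¬ (m ∉ insert m T ∧ R = {m}) from fun h => h.1 (Finset.mem_insert_self m T))]
    ring
  rw [h3, h4, ind_and, ind_and (R = ∅) (T ≠ ∅), ind_and (R = {m}) (T ≠ ∅), ind_not]
  ring

end SplitGeneral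

end Summit.ValiantsHypothesis.ValiantsHypothesis.Theorems.BarrierLever.AnchoredPeeling
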